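import Literature.NumberTheory.Automorphic.Liu2021.AppendixC.RecordCurveSec42Datum
import Literature.NumberTheory.Automorphic.UnitaryGroupHyperspecialHecke
import Literature.AlgebraicGeometry.Motives.AbelianVarietyGoodReductionFrobenius
import Literature.NumberTheory.GaloisRepresentations.HeckeCharacter
import HarnessLib

/-!
# [Liu 2021, App. D, Prop. D.8 (3) and the proof of Cor. D.9] — the Eichler–Shimura congruence relation for the
# Albanese of the unitary Shimura CURVE `M⋆_K`, read in `End` of the reduction (named fact, floor-0 programme P5, letter L3)

Topic `NumberTheory/Automorphic/Liu2021`; namespace `Literature.NumberTheory.Automorphic.Liu2021`.  TWO named facts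
(`def … : Prop`, D-0014: the `∀ R` letter and its weaker MODEL form, the D9op sub-line's registered stub), no `sorry`, no instance, no notation; the
bridge `∀ R ⇒ MODEL` (via the cofinite good-reduction theorem ★ `exists_finite_forall_exists_goodReductionAt_homReduction_tateSpecialisation`)
is the proof-lane sequel `RecordCurveEichlerShimuraBridge.lean`.  Statement typed by F0-typ1 from the letter of record
`D9op-SUBLINE-LETTERS.v0.2` §2 L3 (A-p06 (g17), REF1 (g14) m24 two-denominator form), cell hodgecm-mathlib FLOOR 0.

## The printed result

[Liu2021, App. D] fixes a prime `𝔭` of `E` (our CM field, the tree's `F`), split of degree one over `𝔭⁺` (our `w` with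
`c • w ≠ w`), with `U(V) ⊗ ℚ_p` unramified and the level `K = GL₂(O_𝔭) × K_p^𝔭 × K^p` hyperspecial at `p`, a uniformizer
`ϖ`, `q := #O_𝔭/𝔭`, and proves:

* **Prop. D.8** (arXiv text Prop. 10.8; journal p. 134 L30 – p. 135 L20): (1) the curve `Sh(V,K)` has a SMOOTH model `𝓜_K`
  over `O_𝔭`; (2) `Sh(V, K ∩ K₀(𝔭))` has a stable model `𝓜_{K₀}`; (3) its special fibre `T_{K₀} = T⁺ ∪ T⁻` with
  `π⁺ : T⁺ → T_K` an isomorphism, `π⁻ : T⁻ → T_K` finite flat of degree `q`, the Hecke translation `w_𝔭 ⊗ σ` exchanging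
  `T⁺`, `T⁻`, and `(π⁻ ⊗ 1) ∘ (w_𝔭 ⊗ σ) ∘ (π⁺ ⊗ 1)⁻¹ =` the absolute `q`-th Frobenius of `T_K` (via [Carayol1986Compositio,
  Prop. 10.3] after a change of Shimura datum);
* **Cor. D.9** (arXiv Cor. 10.9; l. 5579–5585): «For every rational prime `ℓ ≠ p`, the action `(σ⁻¹)^*` of the geometric
  Frobenius at `𝔭` on `H¹_ét(Sh(V,K) ⊗_E Ē, ℚ̄_ℓ)` satisfies `X² − T_𝔭^* X + q ⟨ϖ⟩^* = 0`, where `⟨ϖ⟩` is the Hecke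
  translation by `diag(ϖ, ϖ)`» — PROVED (journal p. 139 L3–L31) by «it suffices to prove this identity
  on `T_K`»: the correspondence `T_𝔭` on the special fibre is `π⁻_* ∘ w⁺ ∘ (π⁺)^* + π⁺_* ∘ w⁻ ∘ (π⁻)^*`, whose two summands
  act on `H¹` as `(σ⁻¹)^*` and `q ⟨ϖ⟩^* σ^*` by D.8 (3).

## What is typed here (letter L3 = «print's content below D.9», A-p06 (g17) v0.2 §2/§4)

`H¹_ét` of a smooth projective curve is the dual of the rational Tate module of its Albanese (Milne, *Abelian varieties*,
Thm. 15.1 (a); the tree's `Sec42Data.etaleH1 ℓ K := Module.Dual ℚ_ℓ (V_ℓ (A K))` for the CHOSEN Albanese `A K` of `M⋆_K`,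
★ `RecordCurveSec42Datum`), the geometric Frobenius on `H¹` corresponds to the Frobenius ENDOMORPHISM `π` of the reduction
`Ā_K` on the covariant Tate module (Shimura 1998 (19.4a); the tree's `GoodReductionAt`/`TateSpecialisation`, normalisation
box §4 of the letter memo), and the Hecke operators `T_{w,1} = [K t_ϖ K]`, `T_{w,2} = ⟨ϖ⟩` on the étale tower are, up to
non-zero integers `m₁, m₂`, the transposes `ᵗV_ℓ(θ₁)`, `ᵗV_ℓ(θ₂)` of HONEST endomorphisms `θ₁, θ₂` of `A_K` (★
`Sec42Data.HeckeTranslates.exists_hom_toTower_dualMap_eq_smul_heckeOperator`, [Liu2021, §4.2 l. 2074]).  In that currency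
Cor. D.9 reads, in `End(Ā_K)` (the reductions `θ̄ᵢ := redEnd θᵢ` commute with the central `π`, Tate 1966 §1):

  `m₁ m₂ • π² − m₂ • θ̄₁ π + m₁ q • θ̄₂ = 0`  (`= m₁ m₂ ×` print's `π² − (m₁⁻¹ θ̄₁) π + q (m₂⁻¹ θ̄₂) = 0`),

degree-one homogeneous in `(θ₁, m₁)` and in `(θ₂, m₂)` separately.  The named fact `recordCurve_albanese_eichlerShimura`
asserts exactly this, for every sufficiently small level `K` of the untwisted record curve tower `M⋆ = RecordSystemGS.M`
(★ `UnitaryShimuraCurveRecord`), off a finite set of places `S₀(K)`, at every place `w` of `F` split over `w⁺` with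
`J⋆_w ∈ GL₂(𝒪_w)` and `K` hyperspecial at `w⁺` (token for token the hypotheses of the registered consumer letter
`CorD9OnMOp`, crux dossier `Cruxes/HLiu418/Lines/D6CmCurveBody.lean` :809–:846), for every prime `ℓ`, every pair of
`ℓ`-adically PINNED endomorphisms `(θᵢ, mᵢ)` and every good-reduction datum `R` of `A_K` at `w`.

HONEST LABEL.  This is the special-fibre identity one step BELOW Cor. D.9 (the `ℓ`-adic transport, dualisation, tower
and conjugacy bookkeeping D.9 ⇒ `CorD9OnMOp` is the generic letter L4 over ★ carriers); it is implied by Prop. D.8 (3) +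
the correspondence calculus of the printed proof of D.9, and implies D.9 by Shimura (19.4a).  Its own proof needs the
integral models of D.8 (Liu-specific, via [Carayol1986Compositio] and [LL99]) — tree count 0 today; hence a NAMED FACT
(debt +1), to be discharged by the D9op sub-line.  Nothing else of [Liu2021] is asserted.  HC_CM is proved only modulo
the printed citations until rung 0 closes.

## References
* [Liu2021] Y. Liu, *Fourier–Jacobi cycles and arithmetic relative trace formula*, Camb. J. Math. 9 (2021) =
  arXiv:2102.11518: App. D, Prop. D.8 (arXiv Prop. 10.8), Cor. D.9 (arXiv Cor. 10.9, `FJcycle.tex` l. 5579–5585, journal p. 139 L3–L31);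
  §4.2 (l. 2074).
* [Carayol1986Compositio] H. Carayol, *Sur la mauvaise réduction des courbes de Shimura*, Compositio Math. 59 (1986),
  §10.3 Prop. 10.3 (p. 211).
* [Shimura1998] G. Shimura, *Abelian varieties with complex multiplication and modular functions*, §11.1 Prop. 12,
  §19.4 (19.4a).
* [Tate1966Endomorphisms] J. Tate, *Endomorphisms of abelian varieties over finite fields*, Invent. Math. 2 (1966), §1.
-/

noncomputable section

namespace Literature.NumberTheory.Automorphic.Liu2021

open CategoryTheory _root_.NumberField _root_.IsDedekindDomain
open scoped _root_.Matrix
open Literature.AlgebraicGeometry.Motives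
open Literature.AlgebraicGeometry.Motives.AbelianVariety (rationalTateModuleMap frobeniusHom)
open Literature.AlgebraicGeometry.ShimuraVarieties.UnitaryCanonicalModel
open Literature.NumberTheory.Automorphic Literature.NumberTheory.Automorphic.UnitaryGroup
open Literature.NumberTheory.Automorphic.Liu2021.AppendixC
open Literature.NumberTheory.GaloisRepresentations

/-- **[Liu2021, App. D, Prop. D.8 (3) with the proof of Cor. D.9] — the Eichler–Shimura congruence relation for the
Albanese `A_K = Alb(M⋆_K)` of the unitary Shimura curve, in `End` of its reduction.**  For every CM field `F`
(`[F : ℚ] ≥ 4`), hermitian invertible `J⋆ ∈ M₂(F)`, threshold `K₀`, record curve tower `S` (★ `RecordSystemGS`) with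
Hecke translates defined over `F` (`hU7ₛ`), and every small level `K`, there is a finite
set `S₀` of finite places of `F` such that for every `w ∉ S₀` split over `w⁺` (`c • w ≠ w`) with `J⋆_w ∈ GL₂(𝒪_w)` and
`K` hyperspecial at `w⁺`: for every prime `ℓ`, all endomorphisms `θ₁ θ₂ : A_K ⟶ A_K` and integers `m₁ m₂ ≠ 0` PINNED
to the Hecke operators `T_{w,1} = [K t_ϖ K]`, `T_{w,2} = ⟨ϖ⟩` of the étale tower (`[ᵗV_ℓ(θᵢ) φ]_K = mᵢ • [K t_{w,i} K] [φ]_K`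
for all `φ ∈ H¹_ét(A_K) = (V_ℓ A_K)^∨` — VERBATIM the conclusion shape of ★
`Sec42Data.HeckeTranslates.exists_hom_toTower_dualMap_eq_smul_heckeOperator` at `g = heckeElementAt … i` for `M⋆`'s own
translates `sec42HeckeTranslatesGSM`; the consumer `CorD9OnMOp`'s `heckeTAt … (etaleHeckeDatumGSM …).rhoEt … i` is this
operator by `rfl`, ★ `heckeTAt_def` + ★ `rhoEt_etaleHeckeDatumGSM`), and every good-reduction datum `R`
of `A_K` at `w` with reduction `Ā` and Frobenius endomorphism `π = π_Ā` (`q = N(w)`):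

  `(m₁ m₂) • π ∘ π − m₂ • (θ̄₁ ∘ π) + (m₁ q) • θ̄₂ = 0` in `End(Ā)`, `θ̄ᵢ := R.redEnd θᵢ`

— print's «`X² − T_𝔭^* X + q ⟨ϖ⟩^* = 0` for the geometric Frobenius on `H¹_ét(Sh(V,K) ⊗_E Ē, ℚ̄_ℓ)`» (Cor. D.9) read
on the special fibre `T_K` («it suffices to prove this identity on `T_K`», proof of D.9), i.e. on `V_ℓ(Ā)` with
`(σ⁻¹)^* ↦ π` (Shimura (19.4a)) and the Hecke correspondences as `mᵢ⁻¹ θ̄ᵢ`, multiplied through by `m₁ m₂`.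
[cite: Liu2021, App. D Prop. D.8 (3) (p. 134 L30 – p. 135 L20) and Cor. D.9 (l. 5579–5585) with its proof (p. 139 L3–L31); §4.2 l. 2074]
[cite: Carayol1986Compositio, §10.3 Prop. 10.3 (p. 211)] [cite: Shimura1998, §19.4 (19.4a)] -/
def recordCurve_albanese_eichlerShimura : Prop :=
  ∀ (F : Type) [Field F] [NumberField F] [IsCMField F] (ι₁ : F →+* ℂ)
    (Jstar : Matrix (Fin 2) (Fin 2) F)
    (K₀ : C5.OpenCompactSubgroup ↥(finAdelic ↥(maximalRealSubfield F) F (IsCMField.complexConj F) 2 Jstar))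
    (S : RecordSystemGS F Jstar ι₁ K₀) (hU7ₛ : S.HeckeTranslateDefinedOver)
    (h4 : 4 ≤ Module.finrank ℚ F) (isoₛ : ℕ → Prop)
    (hJ : (Jstar.map (IsCMField.complexConj F))ᵀ = Jstar) (hJu : IsUnit Jstar) (K : C5.SmallLevel K₀),
    ∃ S₀ : Set (HeightOneSpectrum (𝓞 F)), S₀.Finite ∧
      ∀ w : HeightOneSpectrum (𝓞 F), w ∉ S₀ → ∀ hw : (IsCMField.complexConj F) • w ≠ w,
        (UnitaryGroup.isUnit_placeForm Jstar hJu w).unit ∈ glInt 2 (w.adicCompletion F) →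
          UnitaryGroup.IsHyperspecialAt ↥(maximalRealSubfield F) F (IsCMField.complexConj F) 2 Jstar K.1.1
              (w.under (𝓞 ↥(maximalRealSubfield F))) →
          ∀ (ℓ : ℕ) [Fact ℓ.Prime] (θ₁ θ₂ : End ((sec42DataGSM S h4 isoₛ).A K)) (m₁ m₂ : ℤ), m₁ ≠ 0 → m₂ ≠ 0 →
            (∀ φ : (sec42DataGSM S h4 isoₛ).etaleH1 ℓ K,
                (sec42DataGSM S h4 isoₛ).toTower ℓ K ((rationalTateModuleMap ℓ (θ₁ : _ ⟶ _)).dualMap φ) =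
                  (m₁ : ℚ_[ℓ]) •
                    heckeOperator ((sec42HeckeTranslatesGSM S hU7ₛ h4 isoₛ).etHeckeRep ℓ) (K.1.1 : Subgroup _)
                      (UnitaryGroup.heckeElementAt ↥(maximalRealSubfield F) F (IsCMField.complexConj F) 2 Jstar
                        (⟨w, rfl⟩ : UnitaryGroup.PlacesOver F (w.under (𝓞 ↥(maximalRealSubfield F))))
                        (IsCMField.complexConj_ne_one F) hJ hw (UnitaryGroup.isUnit_placeForm Jstar hJu w)
                        (HeckeCharacter.uniformizer F w) 1)
                      ((sec42DataGSM S h4 isoₛ).toTower ℓ K φ)) →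
            (∀ φ : (sec42DataGSM S h4 isoₛ).etaleH1 ℓ K,
                (sec42DataGSM S h4 isoₛ).toTower ℓ K ((rationalTateModuleMap ℓ (θ₂ : _ ⟶ _)).dualMap φ) =
                  (m₂ : ℚ_[ℓ]) •
                    heckeOperator ((sec42HeckeTranslatesGSM S hU7ₛ h4 isoₛ).etHeckeRep ℓ) (K.1.1 : Subgroup _)
                      (UnitaryGroup.heckeElementAt ↥(maximalRealSubfield F) F (IsCMField.complexConj F) 2 Jstar
                        (⟨w, rfl⟩ : UnitaryGroup.PlacesOver F (w.under (𝓞 ↥(maximalRealSubfield F))))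
                        (IsCMField.complexConj_ne_one F) hJ hw (UnitaryGroup.isUnit_placeForm Jstar hJu w)
                        (HeckeCharacter.uniformizer F w) 2)
                      ((sec42DataGSM S h4 isoₛ).toTower ℓ K φ)) →
            ∀ R : ((sec42DataGSM S h4 isoₛ).A K).GoodReductionAt w,
              (m₁ * m₂) • (End.of (frobeniusHom R.reduction) * End.of (frobeniusHom R.reduction)) -
                  m₂ • (R.redEnd θ₁ * End.of (frobeniusHom R.reduction)) +
                  (m₁ * (Ideal.absNorm w.asIdeal : ℤ)) • R.redEnd θ₂ = 0

/-- **[Liu2021, App. D, Prop. D.8 (3) + proof of Cor. D.9] — MODEL FORM** of `recordCurve_albanese_eichlerShimura` (the form the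
D9op sub-line registers as its stub, 24832 registrar A-plan2 (g16) 21:02:35Z; text = A-p05 (g15) rf v2 :86 minus the two dropped
binders): same setting, but at every split hyperspecial `w ∉ S₀(K)` there EXISTS a good-reduction datum `R` of `A_K` at `w`, admitting an
`ℓ`-adic specialisation for every prime `ℓ` with `w ∤ ℓ` (★ `TateSpecialisation`; Shimura 1998 §11.1 Prop. 14, §19.4), such that for every
`ℓ` and every pair of `ℓ`-adically pinned endomorphisms `(θᵢ, mᵢ)` (★ L0 shape) the congruence relation
`(m₁ m₂) • π ∘ π − m₂ • (θ̄₁ ∘ π) + (m₁ q) • θ̄₂ = 0` holds in `End(R.reduction)`.  This is exactly what an integral-model proof delivers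
(`R` := the reduction datum of the Albanese of the smooth model `𝓜_K` of Prop. D.8 (1)), with no transport between two good-reduction data;
it is WEAKER than the `∀ R` form (bridge `recordCurve_albanese_eichlerShimuraModel_of` in the sequel `RecordCurveEichlerShimuraBridge.lean`,
via the cofinite good-reduction theorem ★ `exists_finite_forall_exists_goodReductionAt_homReduction_tateSpecialisation`).
[cite: Liu2021, App. D Prop. D.8 (1)–(3) (p. 134 L30 – p. 135 L20) and Cor. D.9 (l. 5579–5585) with its proof (p. 139 L3–L31); §4.2 l. 2074]
[cite: Carayol1986Compositio, §10.3 Prop. 10.3 (p. 211)] [cite: Shimura1998, §11.1 Prop. 14 and §19.4 (19.4a)] -/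
def recordCurve_albanese_eichlerShimuraModel : Prop :=
  ∀ (F : Type) [Field F] [NumberField F] [IsCMField F] (ι₁ : F →+* ℂ)
    (Jstar : Matrix (Fin 2) (Fin 2) F)
    (K₀ : C5.OpenCompactSubgroup ↥(finAdelic ↥(maximalRealSubfield F) F (IsCMField.complexConj F) 2 Jstar))
    (S : RecordSystemGS F Jstar ι₁ K₀) (hU7ₛ : S.HeckeTranslateDefinedOver)
    (h4 : 4 ≤ Module.finrank ℚ F) (isoₛ : ℕ → Prop)
    (hJ : (Jstar.map (IsCMField.complexConj F))ᵀ = Jstar) (hJu : IsUnit Jstar) (K : C5.SmallLevel K₀),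
    ∃ S₀ : Set (HeightOneSpectrum (𝓞 F)), S₀.Finite ∧
      ∀ w : HeightOneSpectrum (𝓞 F), w ∉ S₀ → ∀ hw : (IsCMField.complexConj F) • w ≠ w,
        (UnitaryGroup.isUnit_placeForm Jstar hJu w).unit ∈ glInt 2 (w.adicCompletion F) →
          UnitaryGroup.IsHyperspecialAt ↥(maximalRealSubfield F) F (IsCMField.complexConj F) 2 Jstar K.1.1
              (w.under (𝓞 ↥(maximalRealSubfield F))) →
          ∃ R : ((sec42DataGSM S h4 isoₛ).A K).GoodReductionAt w,
            (∀ (ℓ : ℕ) [Fact ℓ.Prime], ((ℓ : ℕ) : 𝓞 F) ∉ w.asIdeal → Nonempty (R.TateSpecialisation ℓ)) ∧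
            ∀ (ℓ : ℕ) [Fact ℓ.Prime] (θ₁ θ₂ : End ((sec42DataGSM S h4 isoₛ).A K)) (m₁ m₂ : ℤ), m₁ ≠ 0 → m₂ ≠ 0 →
              (∀ φ : (sec42DataGSM S h4 isoₛ).etaleH1 ℓ K,
                  (sec42DataGSM S h4 isoₛ).toTower ℓ K ((rationalTateModuleMap ℓ (θ₁ : _ ⟶ _)).dualMap φ) =
                    (m₁ : ℚ_[ℓ]) •
                      heckeOperator ((sec42HeckeTranslatesGSM S hU7ₛ h4 isoₛ).etHeckeRep ℓ) (K.1.1 : Subgroup _)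
                        (UnitaryGroup.heckeElementAt ↥(maximalRealSubfield F) F (IsCMField.complexConj F) 2 Jstar
                          (⟨w, rfl⟩ : UnitaryGroup.PlacesOver F (w.under (𝓞 ↥(maximalRealSubfield F))))
                          (IsCMField.complexConj_ne_one F) hJ hw (UnitaryGroup.isUnit_placeForm Jstar hJu w)
                          (HeckeCharacter.uniformizer F w) 1)
                        ((sec42DataGSM S h4 isoₛ).toTower ℓ K φ)) →
              (∀ φ : (sec42DataGSM S h4 isoₛ).etaleH1 ℓ K,
                  (sec42DataGSM S h4 isoₛ).toTower ℓ K ((rationalTateModuleMap ℓ (θ₂ : _ ⟶ _)).dualMap φ) =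
                    (m₂ : ℚ_[ℓ]) •
                      heckeOperator ((sec42HeckeTranslatesGSM S hU7ₛ h4 isoₛ).etHeckeRep ℓ) (K.1.1 : Subgroup _)
                        (UnitaryGroup.heckeElementAt ↥(maximalRealSubfield F) F (IsCMField.complexConj F) 2 Jstar
                          (⟨w, rfl⟩ : UnitaryGroup.PlacesOver F (w.under (𝓞 ↥(maximalRealSubfield F))))
                          (IsCMField.complexConj_ne_one F) hJ hw (UnitaryGroup.isUnit_placeForm Jstar hJu w)
                          (HeckeCharacter.uniformizer F w) 2)
                        ((sec42DataGSM S h4 isoₛ).toTower ℓ K φ)) →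
                (m₁ * m₂) • (End.of (frobeniusHom R.reduction) * End.of (frobeniusHom R.reduction)) -
                    m₂ • (R.redEnd θ₁ * End.of (frobeniusHom R.reduction)) +
                    (m₁ * (Ideal.absNorm w.asIdeal : ℤ)) • R.redEnd θ₂ = 0

end Literature.NumberTheory.Automorphic.Liu2021

end
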